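import Summits.CriticalPhenomena.PercolationContinuityZ3.Theorems.Transplant.SkelFrmQuasiBParamsKitS
import HarnessLib

/-!
# GEN-Q follow-up row L-KitS-1 «SkelFrmQuasiBParamsKitSN» (design-owner ruling 2026-08-27 09:14Z, refuter's located item on G011): THE APRON / KIT INTEGERS OF
# RECORD WITH THE QUASI-STEP COST `N` AS A PARAMETER — `MaN N`, `T₀aN N`, `reachAN N`, `baseAN Φ N`, `rsAN`, `cSAN`, `sBAN`, `BAN`, `LcntAN`, `j₁AN`, `RlevAN`, `RAN'`
# and their ledger facts, plus the cost of record **`NQ Φ := 13 · max Φ.M 1`** of a quasi-step skeleton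

builds on p205010 (kernel theorem, internal audit signed; external expert review pending) — nothing in this file uses p205010; NOTHING is claimed about any open node
((N3-b), the end state).  Lane `prim-bschramm`, seat `prim-hp-8` (gen 62; owner of G011 «SkelFrmQuasiBParamsKitS» p516572).  DEF row (review-queued by D-0009).
Helper file (`--supports stmt-CriticalPhenomena-4575 --as helper`).
WHY (refuter p5-g28's located item on G011, lane INBOX 2026-08-27 09:0xZ; design owner p3-g30's RULING L-KitS-1 09:14Z, ADOPTED with the correction `NQ := 13·max Φ.M 1`).
G011 is the byte-identical carrier-token swap of «SkelFrmFromBParamsKitS»: its tangential surplus `Ma = Kmax + KCmax + W + Rs + 2`, reach `13(T₀+1) + 13d + KCmax`, base,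
`cS = 14(T₀+1) + 14d + (2W+1)(Kmax+1)(Δ+1)^{R'_P}` are sized for the UNIT-STEP kit (window cost `N = 13`, column height `KCmax`).  Under the quasi-step carrier the kit
readers (binder wave, located item L-hp8-1 (b): «SkelPhiForcedColumnQ» … «SkelPhiRunKitsFCQ») discharge their floors with the column radius `N·KCmax`, the column
cardinality `(KCmax+1)(N+2)` and a window cost `N ≥ Φ.M·(kq+3)` (run frames, `kq = 10`), `≥ 3Φ.M` (face frames), `≥ Φ.M` (root frame) — so every integer that absorbs
`KCmax` or the cost must be re-read with `N` as a PARAMETER.  This file declares those N-parametrised variants under NEW names (suffix `N`; the N-free data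
`MK/nKit/…/Rs/Wa/da/ℓsa/Dsh/Kmax/KCmax/RPa/cUA` of «SkelFrmQuasiBParamsKitS» are reused verbatim) with the SAME proofs (`unfold; omega`, `N` opaque), and fixes the
cost of record `NQ Φ := 13 · max Φ.M 1` (dominates `13`, `1`, `Φ.M` and `Φ.M·(kq+3)` for every `kq ≤ 10`; `max Φ.M 1` avoids a `1 ≤ Φ.M` lemma the carrier does not have).
FLOOR RULE (p5): every changed quantity (T₀, reach, base, rs, cS, sB, B, levels, Rlev, R′) is a lower bound on a parameter chosen LATER than `Φ.M`; nothing here bounds `Φ.M`.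
Readers (hand-hunk GEN-Q rows, captain's list): «…BParamsSlotsRS/SlotsT/SlotsTA», «…BChoiceNums» (`kit0`), «…BChoiceResidF/QV», «…BChoiceRows», «…FaceLatA», «…FaceBandA/R0»,
«…BParamsBridgeFrameF», «SkelFrmQuasi1RootHoldsQ3VNodePx» — they take `N := NQ Φ` and `RA' ↦ RAN' (NQ Φ)`, `reachA ↦ reachAN (NQ Φ)`, `T₀a ↦ T₀aN (NQ Φ)`.
* §1 `MaN`, `T₀aN`, `T₀aN_eq`, `hTN_at`, `le_T₀aN`, `MaN_one`/`T₀aN_one` (regression: `N = 1` is G011's `Ma`/`T₀a`), `Ma_le_MaN`, `T₀a_le_T₀aN`;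
* §2 `reachAN`, `baseAN`, `rsAN`, `cSAN`, `sBAN`, `BAN`, `hcSN_at` (the readers' `hcS` shape `(N+1)(T₀+1) + (N+1)d + (KCmax+1)(N+2) + cU ≤ cS` from the unit-step margin);
* §3 `LcntAN`, `j₁AN`, `RlevAN`, `RAN'`, `RAN'_eq`, `j_reachN_le`, `T₀aN_lt_RAN'`, `levels_wideN`;
* §4 **`NQ`**, `thirteen_le_NQ`, `one_le_NQ`, `M_le_NQ`, `M_mul_le_NQ`.
[cite: KozmaNitzan2024, §4 Lemma 10 (pp. 18–21), Theorem 6 (pp. 25–31)] [this work]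
-/

noncomputable section

open scoped Classical

namespace Summit.CriticalPhenomena.PercolationContinuityZ3.Theorems.Transplant

namespace PlanarSkeletonFrmQuasi

namespace NegB

namespace KS

open Literature.Probability.Percolation Literature.Probability.LatticeModels SimpleGraph
open Literature.Barriers.CriticalPhenomena (graphBall)
open SkelConc (Consts)
open BoxProdZ2 (kitK kitN kitL)
open SkelI (tanOff)
open Skelφ.StepI (DataN)
open Neg

/-! ## §1 The tangential surplus and clamp with the column radius `N·KCmax` -/

section Data

/-- **The tangential clamp surplus at window cost `N`**: `M_N := Kmax + N·KCmax + W + Rs + 2` (the quasi-column of a contact has radius `N·KCmax`). [this work] -/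
def MaN {V : Type} (N : ℕ) (t : V) (D : Skelφ.StepI.DataNS V) (mk : ℕ) : ℕ := Kmax t D mk + N * KCmax t D mk + Wa t D mk + Rs t D mk + 2

/-- **The tangential clamp at window cost `N`**: `T₀,N := D_sh + M_N` (`= tanOff ℓs M_N`). [this work] -/
def T₀aN {V : Type} (N : ℕ) (t : V) (D : Skelφ.StepI.DataNS V) (mk : ℕ) : ℕ := Dsh t D mk + MaN N t D mk

/-- `T₀,N = tanOff ℓs M_N`. [folklore] -/
theorem T₀aN_eq {V : Type} (N : ℕ) (t : V) (D : Skelφ.StepI.DataNS V) (mk : ℕ) : T₀aN N t D mk = tanOff (ℓsa t D mk) (MaN N t D mk) := by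
  unfold T₀aN tanOff; rw [Dsh_eq]

/-- **The two clamp floors at window cost `N`**: `W + Kmax + ℓ + 1 ≤ T₀,N` and `D_sh + N·KCmax + Rs ≤ T₀,N` (ℤ shapes as in the quasi-step clauses' `hT`). [folklore] -/
theorem hTN_at {V : Type} (N : ℕ) (t : V) (D : Skelφ.StepI.DataNS V) (mk : ℕ) :
    (Wa t D mk : ℤ) + Kmax t D mk + 1 + 1 ≤ tanOff (ℓsa t D mk) (MaN N t D mk) ∧
      (Dsh t D mk : ℤ) + N * KCmax t D mk + Rs t D mk ≤ tanOff (ℓsa t D mk) (MaN N t D mk) := by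
  rw [← T₀aN_eq]
  constructor
  · have : Wa t D mk + Kmax t D mk + 1 + 1 ≤ T₀aN N t D mk := by unfold T₀aN MaN Dsh; omega
    exact_mod_cast this
  · have : Dsh t D mk + N * KCmax t D mk + Rs t D mk ≤ T₀aN N t D mk := by unfold T₀aN MaN; omega
    exact_mod_cast this

/-- `D_sh ≤ T₀,N`, `Rs + 2 ≤ T₀,N`, `1 ≤ T₀,N`. [folklore] -/
theorem le_T₀aN {V : Type} (N : ℕ) (t : V) (D : Skelφ.StepI.DataNS V) (mk : ℕ) : Dsh t D mk ≤ T₀aN N t D mk ∧ Rs t D mk + 2 ≤ T₀aN N t D mk ∧ 1 ≤ T₀aN N t D mk := by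
  unfold T₀aN Dsh; omega

/-- Regression: at `N = 1` the surplus is G011's `Ma`. [folklore] -/
theorem MaN_one {V : Type} (t : V) (D : Skelφ.StepI.DataNS V) (mk : ℕ) : MaN 1 t D mk = Ma t D mk := by unfold MaN Ma; omega

/-- Regression: at `N = 1` the clamp is G011's `T₀a`. [folklore] -/
theorem T₀aN_one {V : Type} (t : V) (D : Skelφ.StepI.DataNS V) (mk : ℕ) : T₀aN 1 t D mk = T₀a t D mk := by unfold T₀aN T₀a; rw [MaN_one]

/-- The surplus grows with the cost: `Ma ≤ M_N` for `1 ≤ N`. [folklore] -/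
theorem Ma_le_MaN {V : Type} {N : ℕ} (hN : 1 ≤ N) (t : V) (D : Skelφ.StepI.DataNS V) (mk : ℕ) : Ma t D mk ≤ MaN N t D mk := by
  have := Nat.mul_le_mul_right (KCmax t D mk) hN
  unfold MaN Ma; omega

/-- The clamp grows with the cost: `T₀ ≤ T₀,N` for `1 ≤ N`. [folklore] -/
theorem T₀a_le_T₀aN {V : Type} {N : ℕ} (hN : 1 ≤ N) (t : V) (D : Skelφ.StepI.DataNS V) (mk : ℕ) : T₀a t D mk ≤ T₀aN N t D mk := by
  have := Ma_le_MaN hN t D mk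
  unfold T₀aN T₀a; omega

end Data

/-! ## §2 Reach, base, shell radius and the Step-III sizes at window cost `N` -/

section Skel

/-- **The kit reach at window cost `N`**: `reach_N := N·(T₀,N+1) + N·d + N·KCmax` (a level-`j` kit centre sits within `j + reach_N` of the core). [this work] -/
def reachAN {V : Type} (N : ℕ) (t : V) (D : Skelφ.StepI.DataNS V) (mk : ℕ) : ℕ := N * (T₀aN N t D mk + 1) + N * da t D mk + N * KCmax t D mk

/-- **The near/far base at window cost `N`**: `base_N := N·(T₀,N+2) + N·d + (W + Kmax + R'_P) + (N·KCmax + Rs)` (`r₀ ≥ base_N`). [this work] -/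
def baseAN {V : Type} {G : SimpleGraph V} [G.LocallyFinite] (Φ : PlanarSkeletonFrmQuasi G) (N : ℕ) (t : V) (D : Skelφ.StepI.DataNS V) (mk : ℕ) : ℕ :=
  N * (T₀aN N t D mk + 2) + N * da t D mk + (Wa t D mk + Kmax t D mk + RPa Φ t D mk) + (N * KCmax t D mk + Rs t D mk)

/-- The shell radius at window cost `N`: `rs_N := 2·(1 + base_N)`. [this work] -/
def rsAN {V : Type} {G : SimpleGraph V} [G.LocallyFinite] (Φ : PlanarSkeletonFrmQuasi G) (N : ℕ) (t : V) (D : Skelφ.StepI.DataNS V) (mk : ℕ) : ℕ :=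
  2 * (1 + baseAN Φ N t D mk)

/-- The Step-III region-size bound at window cost `N`: `cS_N := (N+1)(T₀,N+1) + (N+1)·d + (N+2)(2W+1)(Kmax+1)(Δ+1)^{R'_P}`. [this work] -/
def cSAN {V : Type} {G : SimpleGraph V} [G.LocallyFinite] (Φ : PlanarSkeletonFrmQuasi G) (N : ℕ) (t : V) (D : Skelφ.StepI.DataNS V) (mk : ℕ) : ℕ :=
  (N + 1) * (T₀aN N t D mk + 1) + (N + 1) * da t D mk + (N + 2) * ((2 * Wa t D mk + 1) * (Kmax t D mk + 1) * (Φ.Δ + 1) ^ RPa Φ t D mk)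

/-- The Step-III seed-size bound at window cost `N`: `sB_N := 1 + Δ·cS_N + cS_N·cU`. [this work] -/
def sBAN {V : Type} {G : SimpleGraph V} [G.LocallyFinite] (Φ : PlanarSkeletonFrmQuasi G) (N : ℕ) (t : V) (D : Skelφ.StepI.DataNS V) (mk : ℕ) : ℕ :=
  1 + Φ.Δ * cSAN Φ N t D mk + cSAN Φ N t D mk * cUA Φ t D mk

/-- The contact multiplier at window cost `N`: `B_N := (Δ+1)^{2·rs_N}`. [this work] -/
def BAN {V : Type} {G : SimpleGraph V} [G.LocallyFinite] (Φ : PlanarSkeletonFrmQuasi G) (N : ℕ) (t : V) (D : Skelφ.StepI.DataNS V) (mk : ℕ) : ℕ :=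
  (Φ.Δ + 1) ^ (2 * rsAN Φ N t D mk)

/-- **The quasi-step clauses' `hcS` at window cost `N`** from the unit-step column margin: if `(KCmax+1) + cU ≤ (2W+1)(Kmax+1)(Δ+1)^{R'_P}` (the kit's standing margin) then
`(N+1)(T₀,N+1) + (N+1)d + (KCmax+1)(N+2) + cU ≤ cS_N`. [folklore] -/
theorem hcSN_at {V : Type} {G : SimpleGraph V} [G.LocallyFinite] (Φ : PlanarSkeletonFrmQuasi G) (N : ℕ) (t : V) (D : Skelφ.StepI.DataNS V) (mk : ℕ) {cU : ℕ}
    (h : KCmax t D mk + 1 + cU ≤ (2 * Wa t D mk + 1) * (Kmax t D mk + 1) * (Φ.Δ + 1) ^ RPa Φ t D mk) :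
    (N + 1) * (T₀aN N t D mk + 1) + (N + 1) * da t D mk + (KCmax t D mk + 1) * (N + 2) + cU ≤ cSAN Φ N t D mk := by
  unfold cSAN
  set Z := (2 * Wa t D mk + 1) * (Kmax t D mk + 1) * (Φ.Δ + 1) ^ RPa Φ t D mk with hZ
  have h1 : (KCmax t D mk + 1) * (N + 2) + cU ≤ (N + 2) * Z := by
    have h2 : (KCmax t D mk + 1 + cU) * (N + 2) ≤ Z * (N + 2) := Nat.mul_le_mul_right _ h
    nlinarith
  omega

end Skel

/-! ## §3 The counts, the levels, `Rlev` and `R′` at window cost `N` -/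

section Counts

/-- **The number of levels at window cost `N`** `Lcnt_N := kitL Δ sB_N B_N δkit p`. [this work] -/
def LcntAN (κ : Consts) {V : Type} [Countable V] {G : SimpleGraph V} [G.LocallyFinite] (Φ : PlanarSkeletonFrmQuasi G) (N : ℕ) (t : V) (p : unitInterval)
    (D : Skelφ.StepI.DataNS V) (mk : ℕ) : ℕ :=
  kitL Φ.Δ (sBAN Φ N t D mk) (BAN Φ N t D mk) (Neg.δkit κ Φ) p

/-- **The last kit level at window cost `N`** `j₁,N := T₀,N + Lcnt_N − 1`. [this work] -/
def j₁AN (κ : Consts) {V : Type} [Countable V] {G : SimpleGraph V} [G.LocallyFinite] (Φ : PlanarSkeletonFrmQuasi G) (N : ℕ) (t : V) (p : unitInterval)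
    (D : Skelφ.StepI.DataNS V) (mk : ℕ) : ℕ :=
  T₀aN N t D mk + LcntAN κ Φ N t p D mk - 1

/-- **The window depth in levels at window cost `N`** `Rlev_N := j₁,N + reach_N`. [this work] -/
def RlevAN (κ : Consts) {V : Type} [Countable V] {G : SimpleGraph V} [G.LocallyFinite] (Φ : PlanarSkeletonFrmQuasi G) (N : ℕ) (t : V) (p : unitInterval)
    (D : Skelφ.StepI.DataNS V) (mk : ℕ) : ℕ :=
  j₁AN κ Φ N t p D mk + reachAN N t D mk

/-- **The kit-level displacement at window cost `N`** `R′_N := Rlev_N + 1`. [cite: KozmaNitzan2024, §4 Theorem 6 (pp. 25–31)] -/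
def RAN' (κ : Consts) {V : Type} [Countable V] {G : SimpleGraph V} [G.LocallyFinite] (Φ : PlanarSkeletonFrmQuasi G) (N : ℕ) (t : V) (p : unitInterval)
    (D : Skelφ.StepI.DataNS V) (mk : ℕ) : ℕ :=
  RlevAN κ Φ N t p D mk + 1

/-- `R′_N = j₁,N + reach_N + 1`, `Rlev_N + 1 = R′_N`, `j₁,N ≤ Rlev_N`. [folklore] -/
theorem RAN'_eq (κ : Consts) {V : Type} [Countable V] {G : SimpleGraph V} [G.LocallyFinite] (Φ : PlanarSkeletonFrmQuasi G) (N : ℕ) (t : V) (p : unitInterval)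
    (D : Skelφ.StepI.DataNS V) (mk : ℕ) :
    RAN' κ Φ N t p D mk = j₁AN κ Φ N t p D mk + reachAN N t D mk + 1 ∧ RlevAN κ Φ N t p D mk + 1 = RAN' κ Φ N t p D mk ∧
      j₁AN κ Φ N t p D mk ≤ RlevAN κ Φ N t p D mk :=
  ⟨rfl, rfl, Nat.le_add_right _ _⟩

/-- **The reach fits under `Rlev_N`**: `j ≤ j₁,N → j + reach_N ≤ Rlev_N`. [folklore] -/
theorem j_reachN_le (κ : Consts) {V : Type} [Countable V] {G : SimpleGraph V} [G.LocallyFinite] (Φ : PlanarSkeletonFrmQuasi G) (N : ℕ) (t : V) (p : unitInterval)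
    (D : Skelφ.StepI.DataNS V) (mk : ℕ) {j : ℕ} (hj : j ≤ j₁AN κ Φ N t p D mk) : j + reachAN N t D mk ≤ RlevAN κ Φ N t p D mk := by
  unfold RlevAN; omega

/-- `T₀,N < R′_N`, `Rs + 2 < R′_N`, `reach_N < R′_N`, `1 ≤ R′_N` (for `1 ≤ N`). [folklore] -/
theorem T₀aN_lt_RAN' (κ : Consts) {V : Type} [Countable V] {G : SimpleGraph V} [G.LocallyFinite] (Φ : PlanarSkeletonFrmQuasi G) {N : ℕ} (hN : 1 ≤ N) (t : V)
    (p : unitInterval) (D : Skelφ.StepI.DataNS V) (mk : ℕ) :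
    T₀aN N t D mk < RAN' κ Φ N t p D mk ∧ Rs t D mk + 2 < RAN' κ Φ N t p D mk ∧ reachAN N t D mk < RAN' κ Φ N t p D mk ∧ 1 ≤ RAN' κ Φ N t p D mk := by
  have h1 : N * (T₀aN N t D mk + 1) ≤ reachAN N t D mk := by unfold reachAN; omega
  have h3 : T₀aN N t D mk + 1 ≤ N * (T₀aN N t D mk + 1) := by
    simpa using Nat.mul_le_mul_right (T₀aN N t D mk + 1) hN
  have h2 := (le_T₀aN N t D mk).2.1
  unfold RAN' RlevAN; omega

/-- **The level boxes are wide enough from `j₀,N := T₀,N` on**: `T₀,N ≤ j → 2·T₀,N ≤ 2j ∧ d + 2 ≤ 2j ∧ D_sh + 1 + d + N·KCmax + Rs ≤ 2j` (the quasi-step clauses'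
`hwide/hdw/hDw` margins for a core `lo ≤ hi` enlarged by `j` on both sides). [folklore] -/
theorem levels_wideN {V : Type} (N : ℕ) (t : V) (D : Skelφ.StepI.DataNS V) (mk : ℕ) {j : ℕ} (hj : T₀aN N t D mk ≤ j) :
    2 * T₀aN N t D mk ≤ 2 * j ∧ da t D mk + 2 ≤ 2 * j ∧ Dsh t D mk + 1 + da t D mk + N * KCmax t D mk + Rs t D mk ≤ 2 * j := by
  refine ⟨by omega, ?_, ?_⟩
  · have := (le_T₀aN N t D mk).2.1; unfold da; omega
  · have h1 : Dsh t D mk + N * KCmax t D mk + Rs t D mk ≤ T₀aN N t D mk := by unfold T₀aN MaN; omega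
    have h2 : 1 + da t D mk ≤ T₀aN N t D mk := by unfold T₀aN Dsh da; omega
    omega

end Counts

/-! ## §4 The window cost of record of a quasi-step skeleton -/

section Cost

/-- **The window cost of record** `N_Q := 13 · max Φ.M 1`: dominates the unit-step cost `13`, `1`, the base cost `Φ.M` (root frame) and `Φ.M·(kq+3)` for every run / face
frame (`kq ≤ 10`). [this work] -/
def NQ {V : Type} {G : SimpleGraph V} [G.LocallyFinite] (Φ : PlanarSkeletonFrmQuasi G) : ℕ := 13 * max Φ.M 1

/-- `13 ≤ N_Q`. [folklore] -/
theorem thirteen_le_NQ {V : Type} {G : SimpleGraph V} [G.LocallyFinite] (Φ : PlanarSkeletonFrmQuasi G) : 13 ≤ NQ Φ := by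
  have := le_max_right Φ.M 1
  unfold NQ; omega

/-- `1 ≤ N_Q`. [folklore] -/
theorem one_le_NQ {V : Type} {G : SimpleGraph V} [G.LocallyFinite] (Φ : PlanarSkeletonFrmQuasi G) : 1 ≤ NQ Φ :=
  le_trans (by norm_num) (thirteen_le_NQ Φ)

/-- `Φ.M ≤ N_Q` (the root frame's `hPN`). [folklore] -/
theorem M_le_NQ {V : Type} {G : SimpleGraph V} [G.LocallyFinite] (Φ : PlanarSkeletonFrmQuasi G) : Φ.M ≤ NQ Φ := by
  have := le_max_left Φ.M 1
  unfold NQ; omega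

/-- `Φ.M · (kq + 3) ≤ N_Q` for every `kq ≤ 10` (the run frames' `hPN` at `kq = 10`, the face frames' at `kq = 0`). [folklore] -/
theorem M_mul_le_NQ {V : Type} {G : SimpleGraph V} [G.LocallyFinite] (Φ : PlanarSkeletonFrmQuasi G) {kq : ℕ} (hkq : kq ≤ 10) : Φ.M * (kq + 3) ≤ NQ Φ := by
  have h1 : Φ.M * (kq + 3) ≤ max Φ.M 1 * 13 := Nat.mul_le_mul (le_max_left _ _) (by omega)
  unfold NQ; rw [Nat.mul_comm 13]; exact h1

end Cost

end KS

end NegB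

end PlanarSkeletonFrmQuasi

end Summit.CriticalPhenomena.PercolationContinuityZ3.Theorems.Transplant

end
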